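import Summits.Ventures.Crystal3D.Theorems.StickyWulffConstantNoReconstructionGainPredSlotBudgetRaisedThreeFrame
import Summits.Ventures.Crystal3D.Theorems.StickyWulffConstantNoReconstructionGainPredSlotBudgetCone
import Summits.Ventures.Crystal3D.Theorems.StickyWulffConstantNoReconstructionGainBarlowGrainFilmCone
import HarnessLib

/-!
# Misoriented Barlow grains tilted by at most 70.5° gain nothing (rung F-C1 of the crux chain)

HONEST FRAMING. Part of the venture `Summits/Ventures/Crystal3D` (cell `crystal3d-full`), supports the
crux `NoReconstructionGain` (stmt-Ventures-19144, route `route-Ventures-StickyWulffConstant`), line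
`adhesion` (wulff-p1 g13–g15).  With B1b₃ (`predSlotBudget_of_upBond_raised_three`,
`…PredSlotBudgetRaisedThreeFrame`) landed, the line's skeleton composition is now unconditional:
* `predSlotBudget_of_upBond_raised` — B1b, from B1b₂ (`#K ≤ 2`) and B1b₃ (`#K = 3`);
* `predSlotBudget70` — the pred-slot budget for every lattice frame whose axis is within `70.5°` of `−ν`
  (B1a `predSlotBudget_of_upTriple_below` when all three up bonds are `ν`-below, else B1b);
* `barlowGrainFilm_slab70` — RUNG: a misoriented grain of ANY Barlow stacking whose basal plane is
  tilted by at most `70.5°` from the cut plane gains nothing, at every normal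
  (`barlowGrainFilm_slab_of_predSlotBudget`, reading the grain backwards when the axis points to `+ν`).

WHAT THIS IS NOT: the crux (the general adhesion atom `stub_adhesion_core` / tilts beyond `70.5°` remain
open); this is the rung F-C1 of the line, not `NoReconstructionGain`.
-/

noncomputable section

namespace Summit.Ventures.Crystal3D.Theorems

open Summit.Ventures.Crystal3D Finset
open Literature.MathematicalPhysics.StatisticalMechanics (fccStacking barlowStacking barlowPos constHagg IsHaggSeq
  threeOffsets orderedContacts contactDeficiency)
open scoped InnerProductSpace

/-- **BRICK B1b: the pred-slot budget when some up bond is raised**, composed from the landed B1b₂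
(`predSlotBudget_of_upBond_raised_le_two`, `#K ≤ 2`) and B1b₃ (`predSlotBudget_of_upBond_raised_three`,
`#K = 3`). -/
theorem predSlotBudget_of_upBond_raised :
    ∀ A : EuclideanSpace ℝ (Fin 3) ≃ₗᵢ[ℝ] EuclideanSpace ℝ (Fin 3), ∀ ν : EuclideanSpace ℝ (Fin 3), ‖ν‖ = 1 →
      ⟪ν, A (EuclideanSpace.single (2 : Fin 3) (1 : ℝ))⟫_ℝ ≤ -(1 / 3) →
      ∀ t : ℝ, 0 < t → ∀ K : Finset (EuclideanSpace ℝ (Fin 3)), K.card ≤ 3 →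
        (∀ u ∈ K, ‖u‖ = 1 ∧ ⟪u, ν⟫_ℝ ≤ -t) →
        (∀ u ∈ K, ∀ u' ∈ K, u ≠ u' →
          ⟪u, u'⟫_ℝ = 1 / 2 ∨ ⟪u, u'⟫_ℝ = 0 ∨ ⟪u, u'⟫_ℝ = -1 / 2) →
        ∀ ε : ℤ, (ε = 1 ∨ ε = -1) →
        (∃ o ∈ threeOffsets (-ε),
          0 ≤ ⟪A (barlowPos 1 (Real.sqrt (2 / 3)) (fun _ : ℤ => ε) 1 (-o.1) (-o.2)), ν⟫_ℝ) →
        (K.card : ℝ) ≤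
          (if (∃ u ∈ K, 1 / 2 < ⟪u, if ⟪A (barlowPos 1 (Real.sqrt (2 / 3)) constHagg 0 1 0), ν⟫_ℝ < 0
                then A (barlowPos 1 (Real.sqrt (2 / 3)) constHagg 0 1 0)
                else -A (barlowPos 1 (Real.sqrt (2 / 3)) constHagg 0 1 0)⟫_ℝ) ∨
              ⟪(if ⟪A (barlowPos 1 (Real.sqrt (2 / 3)) constHagg 0 1 0), ν⟫_ℝ < 0
                then A (barlowPos 1 (Real.sqrt (2 / 3)) constHagg 0 1 0)
                else -A (barlowPos 1 (Real.sqrt (2 / 3)) constHagg 0 1 0)), ν⟫_ℝ ≤ -t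
            then (1 : ℝ) else 0) +
          (if (∃ u ∈ K, 1 / 2 < ⟪u, if ⟪A (barlowPos 1 (Real.sqrt (2 / 3)) constHagg 0 0 1), ν⟫_ℝ < 0
                then A (barlowPos 1 (Real.sqrt (2 / 3)) constHagg 0 0 1)
                else -A (barlowPos 1 (Real.sqrt (2 / 3)) constHagg 0 0 1)⟫_ℝ) ∨
              ⟪(if ⟪A (barlowPos 1 (Real.sqrt (2 / 3)) constHagg 0 0 1), ν⟫_ℝ < 0
                then A (barlowPos 1 (Real.sqrt (2 / 3)) constHagg 0 0 1)
                else -A (barlowPos 1 (Real.sqrt (2 / 3)) constHagg 0 0 1)), ν⟫_ℝ ≤ -t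
            then (1 : ℝ) else 0) +
          (if (∃ u ∈ K, 1 / 2 < ⟪u, if ⟪A (barlowPos 1 (Real.sqrt (2 / 3)) constHagg 0 1 (-1)), ν⟫_ℝ < 0
                then A (barlowPos 1 (Real.sqrt (2 / 3)) constHagg 0 1 (-1))
                else -A (barlowPos 1 (Real.sqrt (2 / 3)) constHagg 0 1 (-1))⟫_ℝ) ∨
              ⟪(if ⟪A (barlowPos 1 (Real.sqrt (2 / 3)) constHagg 0 1 (-1)), ν⟫_ℝ < 0
                then A (barlowPos 1 (Real.sqrt (2 / 3)) constHagg 0 1 (-1))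
                else -A (barlowPos 1 (Real.sqrt (2 / 3)) constHagg 0 1 (-1))), ν⟫_ℝ ≤ -t
            then (1 : ℝ) else 0) +
          (((threeOffsets (-ε)).filter fun o =>
            (∃ u ∈ K, 1 / 2 < ⟪u, A (barlowPos 1 (Real.sqrt (2 / 3)) (fun _ : ℤ => ε) 1 (-o.1) (-o.2))⟫_ℝ) ∨
              ⟪A (barlowPos 1 (Real.sqrt (2 / 3)) (fun _ : ℤ => ε) 1 (-o.1) (-o.2)), ν⟫_ℝ ≤ -t).card : ℝ) := by
  intro A ν hν hax t ht K hK hK1 hK2 ε hε hraised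
  rcases Nat.lt_or_ge K.card 3 with hlt | hge
  · exact predSlotBudget_of_upBond_raised_le_two A ν hν hax t ht K hK hK1 hK2 ε hε hraised (by omega)
  · exact predSlotBudget_of_upBond_raised_three A ν hν hax t ht K hK hK1 hK2 ε hε hraised (by omega)

/-- **THE BRICK `predSlotBudget70` (registered g13 stub `stub_predSlotBudget70`, now a theorem), COMPOSED from B1a
(`predSlotBudget_of_upTriple_below`) and B1b (`predSlotBudget_of_upBond_raised`).**  For a linear
isometry `A` whose image of the stacking axis lies within `70.5°` of `−ν` (`⟪ν, A e₃⟫ ≤ −1/3`): for every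
depth `t > 0`, every set `K` of at most three unit vectors `ν`-below by `t` with pairwise lattice angles,
and either letter `ε = ±1`, `#K` is at most the number of CREDITED directions among the three `ν`-lower
in-plane bonds `±A·h_j` and the three up bonds `A·pos_ε(1, −o)` (`o ∈ threeOffsets(−ε)`). -/
theorem predSlotBudget70 :
    ∀ A : EuclideanSpace ℝ (Fin 3) ≃ₗᵢ[ℝ] EuclideanSpace ℝ (Fin 3), ∀ ν : EuclideanSpace ℝ (Fin 3), ‖ν‖ = 1 →
      ⟪ν, A (EuclideanSpace.single (2 : Fin 3) (1 : ℝ))⟫_ℝ ≤ -(1 / 3) →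
      ∀ t : ℝ, 0 < t → ∀ K : Finset (EuclideanSpace ℝ (Fin 3)), K.card ≤ 3 →
        (∀ u ∈ K, ‖u‖ = 1 ∧ ⟪u, ν⟫_ℝ ≤ -t) →
        (∀ u ∈ K, ∀ u' ∈ K, u ≠ u' →
          ⟪u, u'⟫_ℝ = 1 / 2 ∨ ⟪u, u'⟫_ℝ = 0 ∨ ⟪u, u'⟫_ℝ = -1 / 2) →
        ∀ ε : ℤ, (ε = 1 ∨ ε = -1) →
        (K.card : ℝ) ≤
          (if (∃ u ∈ K, 1 / 2 < ⟪u, if ⟪A (barlowPos 1 (Real.sqrt (2 / 3)) constHagg 0 1 0), ν⟫_ℝ < 0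
                then A (barlowPos 1 (Real.sqrt (2 / 3)) constHagg 0 1 0)
                else -A (barlowPos 1 (Real.sqrt (2 / 3)) constHagg 0 1 0)⟫_ℝ) ∨
              ⟪(if ⟪A (barlowPos 1 (Real.sqrt (2 / 3)) constHagg 0 1 0), ν⟫_ℝ < 0
                then A (barlowPos 1 (Real.sqrt (2 / 3)) constHagg 0 1 0)
                else -A (barlowPos 1 (Real.sqrt (2 / 3)) constHagg 0 1 0)), ν⟫_ℝ ≤ -t
            then (1 : ℝ) else 0) +
          (if (∃ u ∈ K, 1 / 2 < ⟪u, if ⟪A (barlowPos 1 (Real.sqrt (2 / 3)) constHagg 0 0 1), ν⟫_ℝ < 0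
                then A (barlowPos 1 (Real.sqrt (2 / 3)) constHagg 0 0 1)
                else -A (barlowPos 1 (Real.sqrt (2 / 3)) constHagg 0 0 1)⟫_ℝ) ∨
              ⟪(if ⟪A (barlowPos 1 (Real.sqrt (2 / 3)) constHagg 0 0 1), ν⟫_ℝ < 0
                then A (barlowPos 1 (Real.sqrt (2 / 3)) constHagg 0 0 1)
                else -A (barlowPos 1 (Real.sqrt (2 / 3)) constHagg 0 0 1)), ν⟫_ℝ ≤ -t
            then (1 : ℝ) else 0) +
          (if (∃ u ∈ K, 1 / 2 < ⟪u, if ⟪A (barlowPos 1 (Real.sqrt (2 / 3)) constHagg 0 1 (-1)), ν⟫_ℝ < 0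
                then A (barlowPos 1 (Real.sqrt (2 / 3)) constHagg 0 1 (-1))
                else -A (barlowPos 1 (Real.sqrt (2 / 3)) constHagg 0 1 (-1))⟫_ℝ) ∨
              ⟪(if ⟪A (barlowPos 1 (Real.sqrt (2 / 3)) constHagg 0 1 (-1)), ν⟫_ℝ < 0
                then A (barlowPos 1 (Real.sqrt (2 / 3)) constHagg 0 1 (-1))
                else -A (barlowPos 1 (Real.sqrt (2 / 3)) constHagg 0 1 (-1))), ν⟫_ℝ ≤ -t
            then (1 : ℝ) else 0) +
          (((threeOffsets (-ε)).filter fun o =>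
            (∃ u ∈ K, 1 / 2 < ⟪u, A (barlowPos 1 (Real.sqrt (2 / 3)) (fun _ : ℤ => ε) 1 (-o.1) (-o.2))⟫_ℝ) ∨
              ⟪A (barlowPos 1 (Real.sqrt (2 / 3)) (fun _ : ℤ => ε) 1 (-o.1) (-o.2)), ν⟫_ℝ ≤ -t).card : ℝ) := by
  intro A ν hν hax t ht K hK hK1 hK2 ε hε
  by_cases hup : ∀ o ∈ threeOffsets (-ε),
      ⟪A (barlowPos 1 (Real.sqrt (2 / 3)) (fun _ : ℤ => ε) 1 (-o.1) (-o.2)), ν⟫_ℝ < 0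
  · exact predSlotBudget_of_upTriple_below A ν hν hax t ht K hK hK1 hK2 ε hε hup
  · push Not at hup
    exact predSlotBudget_of_upBond_raised A ν hν hax t ht K hK hK1 hK2 ε hε hup

/-- **RUNG (proved here modulo `predSlotBudget70`): misoriented grains of ANY Barlow stacking whose
basal plane is tilted by at most `70.5°` from the cut plane (`|⟪ν, A e₃⟫| ≥ 1/3`) gain nothing, at every
normal** — film above the cut, off `Λ₀`, inside `A · barlowStacking 1 √(2/3) σ + c`; constants of
`barlowGrainFilm_slab_of_predSlotBudget` (`R = 1`, `C = 0`).  Axis towards `−ν`: the brick directly; axis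
towards `+ν`: read the grain backwards (`reversed_grain_mem`, `…BarlowGrainFilmCone`). -/
theorem barlowGrainFilm_slab70 :
    ∃ R C : ℝ, 1 ≤ R ∧ ∀ σ : ℤ → ℤ, IsHaggSeq σ →
      ∀ (A : EuclideanSpace ℝ (Fin 3) ≃ₗᵢ[ℝ] EuclideanSpace ℝ (Fin 3)) (c : EuclideanSpace ℝ (Fin 3)),
      ∀ ν : EuclideanSpace ℝ (Fin 3), ‖ν‖ = 1 →
      1 / 3 ≤ |⟪ν, A (EuclideanSpace.single (2 : Fin 3) (1 : ℝ))⟫_ℝ| →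
      ∀ ρ : ℝ, R ≤ ρ →
      ∀ X P : Finset (EuclideanSpace ℝ (Fin 3)),
      (∀ p ∈ X, ∀ q ∈ X, p ≠ q → 1 ≤ dist p q) → P ⊆ X →
      (∀ p, p ∈ P ↔ (p ∈ fccStacking 1 (Real.sqrt (2 / 3)) ∧ -(2 * R) ≤ ⟪p, ν⟫_ℝ ∧
        ⟪p, ν⟫_ℝ ≤ -R ∧ ‖p‖ ^ 2 - ⟪p, ν⟫_ℝ ^ 2 ≤ ρ ^ 2)) →
      (∀ q ∈ X \ P, -R < ⟪q, ν⟫_ℝ) →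
      (∀ q ∈ X \ P, q ∉ fccStacking 1 (Real.sqrt (2 / 3))) →
      (∀ q ∈ X \ P, q ∈ (fun p => A p + c) '' barlowStacking 1 (Real.sqrt (2 / 3)) σ) →
      ((((P ×ˢ (X \ P)).filter fun pq => dist pq.1 pq.2 = 1).card : ℕ) : ℝ) ≤
        contactDeficiency (X \ P) + C * ρ := by
  obtain ⟨R, C, hR, h⟩ := barlowGrainFilm_slab_of_predSlotBudget
  refine ⟨R, C, hR, ?_⟩
  intro σ hσ A c ν hν htilt ρ hρ X P hX hPX hP habove hoff hgrain
  rcases le_abs'.1 htilt with hneg | hpos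
  · -- axis towards `−ν`: the brick applies to `A` itself
    exact h σ hσ A c ν hν (predSlotBudget70 A ν hν (by linarith)) ρ hρ X P hX hPX hP habove hoff hgrain
  · -- axis towards `+ν`: read the grain backwards
    set M : EuclideanSpace ℝ (Fin 3) ≃ₗᵢ[ℝ] EuclideanSpace ℝ (Fin 3) :=
      (ℝ ∙ (EuclideanSpace.single (2 : Fin 3) (1 : ℝ)))ᗮ.reflection with hM
    have htilt' : ⟪ν, (M.trans A) (EuclideanSpace.single (2 : Fin 3) (1 : ℝ))⟫_ℝ ≤ -(1 / 3) := by
      rw [LinearIsometryEquiv.trans_apply, hM, basalMirror_e3, map_neg, inner_neg_right]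
      linarith
    exact h _ (isHaggSeq_reverse hσ) (M.trans A) c ν hν (predSlotBudget70 _ ν hν htilt') ρ hρ X P hX
      hPX hP habove hoff fun q hq => reversed_grain_mem A c q (hgrain q hq)

end Summit.Ventures.Crystal3D.Theorems

end
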